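import Literature.NumberTheory.LFunctions.KloostermanFractionsAmplifiedForm
import Literature.NumberTheory.LFunctions.KloostermanIncompleteInterval
import HarnessLib

/-!
# Bilinear forms with Kloosterman fractions: the sum over `m` for a pair of moduli (CRT + Weil)

Topic `NumberTheory/LFunctions`.  The arithmetic input of Duke–Friedlander–Iwaniec, *Bilinear
forms with Kloosterman fractions*, Invent. Math. 128 (1997), Theorem 5 (the Weil bound for the
second moment `∑_m |∑_n β_n e(k m̄/n)|²`, see `KloostermanFractionsWeilBound.lean`): after
expanding the square one meets, for a pair of moduli `n₁, n₂`, the sum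
`∑_{m ≤ A, (m, n₁ n₂) = 1} e(k m̄⁽ⁿ¹⁾/n₁) conj e(k m̄⁽ⁿ²⁾/n₂)`.  Everything here is PROVED:

* `DFI_kfPhase_mul_conj` — Chinese remainder: the summand is `e(kc · m̄⁽Q⁾/Q)` with `Q = [n₁,n₂]`,
  `g = (n₁,n₂)`, `c = n₂/g - n₁/g`;
* `DFI_gcd_kc_lcm_le` — `(kc, Q) ≤ g` when `n₁, n₂` are coprime to `k`;
* `KI_sum_Icc_coprime_le` — the tree's completion + Weil estimate `KI_sum_progression_le`
  (`KloostermanIncompleteInterval.lean`, Bettin–Chandee Appendix Lemma 1 = DFI Lemma 8) over the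
  natural numbers `1 ≤ m ≤ A`;
* **`DFI_pairSum_norm_le`** — hence
  `|∑_{m ≤ A,(m,n₁n₂)=1} e(k m̄/n₁) conj e(k m̄/n₂)| ≤ A g²/(n₁n₂) + τ(Q) (n₁n₂)^{1/2} (1 + log Q)`;
* `DFI_sum_gcd_le` — the gcd sum `∑_{n₂ ≤ X} (n₁, n₂) ≤ X τ(n₁)` used to average the first term.

(`kfPhase k q m = e(k m̄⁽q⁾/q)` is the tree's definition, `KloostermanFractionsAmplifiedForm.lean`.)

## References

* W. Duke, J. Friedlander, H. Iwaniec, Invent. Math. 128 (1997) 23–43, Theorem 5 (proof) and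
  Lemma 8. [DukeFriedlanderIwaniec1997]
* S. Bettin, V. Chandee, Adv. Math. 328 (2018) 1234–1262 (arXiv:1502.00769), §3 and Appendix
  Lemma 1. [BettinChandee2018]
-/

noncomputable section

open Finset

namespace Literature.NumberTheory.LFunctions

/-- **Chinese remainder for a pair of Kloosterman fractions.**  For `n₁, n₂ ≥ 1` and
`(m, n₁) = (m, n₂) = 1`, with `g = (n₁, n₂)`, `Q = [n₁, n₂]`, `c = n₂/g - n₁/g`:
`e(k m̄⁽ⁿ¹⁾/n₁) · conj e(k m̄⁽ⁿ²⁾/n₂) = e((kc) m̄⁽Q⁾/Q)` (the inverses modulo `n₁`, `n₂` are the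
reductions of the inverse modulo `Q`, and `1/n₁ - 1/n₂ = c/Q`). [folklore] -/
theorem DFI_kfPhase_mul_conj (k : ℤ) {n₁ n₂ m : ℕ} (hn₁ : 0 < n₁) (hn₂ : 0 < n₂)
    (h₁ : m.Coprime n₁) (h₂ : m.Coprime n₂) :
    kfPhase k n₁ m * (starRingEnd ℂ) (kfPhase k n₂ m) =
      kfPhase (k * (((n₂ / n₁.gcd n₂ : ℕ) : ℤ) - ((n₁ / n₁.gcd n₂ : ℕ) : ℤ))) (n₁.lcm n₂) m := by
  set g : ℕ := n₁.gcd n₂ with hg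
  set Q : ℕ := n₁.lcm n₂ with hQ
  have hg0 : 0 < g := Nat.gcd_pos_of_pos_left _ hn₁
  have hQ0 : 0 < Q := Nat.lcm_pos hn₁ hn₂
  haveI : NeZero Q := ⟨hQ0.ne'⟩
  haveI : NeZero n₁ := ⟨hn₁.ne'⟩
  haveI : NeZero n₂ := ⟨hn₂.ne'⟩
  have hmQ : m.Coprime Q :=
    Nat.Coprime.coprime_dvd_right (Nat.lcm_dvd_mul n₁ n₂) (Nat.Coprime.mul_right h₁ h₂)
  set u : ℕ := ((m : ZMod Q)⁻¹).val with hu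
  set u₁ : ℕ := ((m : ZMod n₁)⁻¹).val with hu₁
  set u₂ : ℕ := ((m : ZMod n₂)⁻¹).val with hu₂
  -- the inverses modulo `n₁`, `n₂` are the reductions of the inverse modulo `Q`
  have hred : ∀ {n : ℕ} [NeZero n], n ∣ Q → u % n = ((m : ZMod n)⁻¹).val := by
    intro n _ hnQ
    have hunit : IsUnit ((m : ℕ) : ZMod Q) := (ZMod.isUnit_iff_coprime m Q).mpr hmQ
    have hcast := ZMod.cast_inv_of_isUnit (q := Q) (q' := n) hnQ hunit
    rw [ZMod.cast_eq_val, ZMod.cast_natCast hnQ] at hcast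
    have h2 := congrArg ZMod.val hcast
    rwa [ZMod.val_natCast] at h2
  obtain ⟨t₁, ht₁⟩ : ∃ t₁ : ℕ, (u₁ : ℤ) + n₁ * t₁ = u := by
    refine ⟨u / n₁, ?_⟩
    have := Nat.mod_add_div u n₁
    rw [hred (Nat.dvd_lcm_left n₁ n₂)] at this
    exact_mod_cast this
  obtain ⟨t₂, ht₂⟩ : ∃ t₂ : ℕ, (u₂ : ℤ) + n₂ * t₂ = u := by
    refine ⟨u / n₂, ?_⟩
    have := Nat.mod_add_div u n₂
    rw [hred (Nat.dvd_lcm_right n₁ n₂)] at this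
    exact_mod_cast this
  -- `n₁ n₂ = g Q` and `n₂ - n₁ = g c`
  have hgQ : (g : ℤ) * Q = n₁ * n₂ := by exact_mod_cast Nat.gcd_mul_lcm n₁ n₂
  set c : ℤ := ((n₂ / g : ℕ) : ℤ) - ((n₁ / g : ℕ) : ℤ) with hc
  have hgc : (g : ℤ) * c = n₂ - n₁ := by
    have e1 : ((n₁ / g : ℕ) : ℤ) * g = n₁ := by
      exact_mod_cast Nat.div_mul_cancel (Nat.gcd_dvd_left n₁ n₂)
    have e2 : ((n₂ / g : ℕ) : ℤ) * g = n₂ := by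
      exact_mod_cast Nat.div_mul_cancel (Nat.gcd_dvd_right n₁ n₂)
    rw [hc]; linear_combination e2 - e1
  -- compare the exponents
  unfold kfPhase
  rw [← Complex.exp_conj, ← Complex.exp_add]
  apply Complex.exp_eq_exp_iff_exists_int.mpr
  refine ⟨k * (t₂ : ℤ) - k * (t₁ : ℤ), ?_⟩
  have hn₁C : (n₁ : ℂ) ≠ 0 := by exact_mod_cast hn₁.ne'
  have hn₂C : (n₂ : ℂ) ≠ 0 := by exact_mod_cast hn₂.ne'
  have hQC : (Q : ℂ) ≠ 0 := by exact_mod_cast hQ0.ne'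
  have hu₁C : (u₁ : ℂ) = (u : ℂ) - (n₁ : ℂ) * (t₁ : ℂ) := by
    have : ((u₁ : ℤ) : ℂ) = ((u : ℤ) : ℂ) - ((n₁ : ℤ) : ℂ) * ((t₁ : ℤ) : ℂ) := by
      rw [← ht₁]; push_cast; ring
    exact_mod_cast this
  have hu₂C : (u₂ : ℂ) = (u : ℂ) - (n₂ : ℂ) * (t₂ : ℂ) := by
    have : ((u₂ : ℤ) : ℂ) = ((u : ℤ) : ℂ) - ((n₂ : ℤ) : ℂ) * ((t₂ : ℤ) : ℂ) := by
      rw [← ht₂]; push_cast; ring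
    exact_mod_cast this
  have hgQC : (g : ℂ) * Q = n₁ * n₂ := by exact_mod_cast hgQ
  have hgcC : (g : ℂ) * (c : ℂ) = n₂ - n₁ := by exact_mod_cast hgc
  simp only [map_mul, map_div₀, map_ofNat, Complex.conj_ofReal, Complex.conj_I, map_intCast,
    map_natCast]
  rw [hu₁C, hu₂C]
  push_cast
  field_simp
  linear_combination (-((k : ℂ) * u * Q)) * hgcC + ((k : ℂ) * u * c) * hgQC

/-- `|e(k m̄/q)| = 1`. [folklore] -/
theorem DFI_norm_kfPhase (k : ℤ) (q m : ℕ) : ‖kfPhase k q m‖ = 1 := by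
  unfold kfPhase
  have h : (2 * Real.pi * Complex.I * ((k : ℂ) * ((((m : ZMod q)⁻¹).val : ℕ) : ℂ) / (q : ℂ))) =
      ((2 * Real.pi * ((k : ℝ) * ((((m : ZMod q)⁻¹).val : ℕ) : ℝ) / (q : ℝ)) : ℝ) : ℂ) * Complex.I := by
    push_cast; ring
  rw [h, Complex.norm_exp_ofReal_mul_I]

/-- **Incomplete Kloosterman sum over an initial segment** (the case `q = 1`, `v = 0` of
`KI_sum_progression_le`, re-indexed by natural numbers): for `s ≥ 1`, any `a ∈ ℤ` and `A ≥ 0`,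
`‖∑_{1 ≤ m ≤ A, (m,s)=1} e(a m̄/s)‖ ≤ (A/s)(a,s) + τ(s) s^{1/2} (a,s)^{1/2} (1 + log s)`.
[cite: BettinChandee2018, Appendix Lemma 1] -/
theorem KI_sum_Icc_coprime_le {s : ℕ} (hs : 0 < s) (a : ℤ) (A : ℕ) :
    ‖∑ m ∈ (Icc 1 A).filter (fun m => m.Coprime s), kfPhase a s m‖ ≤
      (A : ℝ) / s * Int.gcd a s +
        (Nat.divisors s).card * Real.sqrt s * Real.sqrt (Int.gcd a s) * (1 + Real.log s) := by
  have h := KI_sum_progression_le hs (q := 1) (Nat.coprime_one_left s) a 0 0 A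
    (by exact_mod_cast Nat.zero_le A)
  simp only [zero_add, one_mul, sub_zero, Int.cast_natCast, Nat.cast_one] at h
  have hsum : ∑ m ∈ (Icc 1 A).filter (fun m => m.Coprime s), kfPhase a s m =
      ∑ y ∈ (Ioc (0 : ℤ) A).filter (fun y : ℤ => Int.gcd y s = 1),
        Complex.exp (2 * Real.pi * Complex.I *
          ((a : ℂ) * ((((y : ZMod s)⁻¹).val : ℕ) : ℂ) / (s : ℂ))) := by
    refine Finset.sum_nbij' (fun m : ℕ => (m : ℤ)) (fun y : ℤ => y.toNat) ?_ ?_ ?_ ?_ ?_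
    · intro m hm
      rw [Finset.mem_filter, Finset.mem_Icc] at hm
      rw [Finset.mem_filter, Finset.mem_Ioc, Int.gcd_natCast_natCast]
      exact ⟨⟨by exact_mod_cast hm.1.1, by exact_mod_cast hm.1.2⟩, hm.2⟩
    · intro y hy
      rw [Finset.mem_filter, Finset.mem_Ioc] at hy
      obtain ⟨⟨hy0, hyA⟩, hg⟩ := hy
      have hy' : ((y.toNat : ℕ) : ℤ) = y := Int.toNat_of_nonneg hy0.le
      rw [Finset.mem_filter, Finset.mem_Icc]
      refine ⟨⟨?_, ?_⟩, ?_⟩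
      · have : (1 : ℤ) ≤ y.toNat := by rw [hy']; omega
        exact_mod_cast this
      · have : (y.toNat : ℤ) ≤ A := by rw [hy']; exact hyA
        exact_mod_cast this
      · rw [← hy', Int.gcd_natCast_natCast] at hg
        exact hg
    · intro m _
      exact Int.toNat_natCast m
    · intro y hy
      rw [Finset.mem_filter, Finset.mem_Ioc] at hy
      exact Int.toNat_of_nonneg hy.1.1.le
    · intro m _
      simp only [kfPhase, Int.cast_natCast]
  rw [hsum]
  exact h

/-- **The greatest common divisor in the Weil bound.**  For `n₁, n₂ ≥ 1` both coprime to `k`,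
`g = (n₁, n₂)`, `Q = [n₁, n₂]` and `c = n₂/g - n₁/g`: `(k c, Q) ≤ g` (indeed `(kc, Q) = (c, g)`,
since `(k, Q) = 1`, `Q = g (n₁/g)(n₂/g)` and `c` is coprime to `n₁/g` and to `n₂/g`). [folklore] -/
theorem DFI_gcd_kc_lcm_le (k : ℤ) {n₁ n₂ : ℕ} (hn₁ : 0 < n₁)
    (hk₁ : n₁.Coprime k.natAbs) (hk₂ : n₂.Coprime k.natAbs) :
    Int.gcd (k * (((n₂ / n₁.gcd n₂ : ℕ) : ℤ) - ((n₁ / n₁.gcd n₂ : ℕ) : ℤ))) (n₁.lcm n₂) ≤ n₁.gcd n₂ := by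
  set g : ℕ := n₁.gcd n₂ with hg
  set Q : ℕ := n₁.lcm n₂ with hQ
  set n₁' : ℕ := n₁ / g with hn₁'
  set n₂' : ℕ := n₂ / g with hn₂'
  set c : ℤ := (n₂' : ℤ) - (n₁' : ℤ) with hc
  have hg0 : 0 < g := Nat.gcd_pos_of_pos_left _ hn₁
  -- `(k, Q) = 1`
  have hkQ : Nat.Coprime k.natAbs Q := by
    have h12 : Nat.Coprime (n₁ * n₂) k.natAbs := Nat.Coprime.mul_left hk₁ hk₂
    exact (Nat.Coprime.coprime_dvd_left (Nat.lcm_dvd_mul n₁ n₂) h12).symm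
  -- `Q = g n₁' n₂'`
  have hQeq : Q = n₂' * (n₁' * g) := by
    have h1 : g * Q = n₁ * n₂ := Nat.gcd_mul_lcm n₁ n₂
    have e1 : n₁' * g = n₁ := Nat.div_mul_cancel (Nat.gcd_dvd_left n₁ n₂)
    have e2 : n₂' * g = n₂ := Nat.div_mul_cancel (Nat.gcd_dvd_right n₁ n₂)
    have h2 : g * Q = g * (n₂' * (n₁' * g)) := by
      rw [h1, ← e1, ← e2]; ring
    exact Nat.eq_of_mul_eq_mul_left hg0 h2
  -- `c` is coprime to `n₁'` and to `n₂'`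
  have hcop : Nat.Coprime n₁' n₂' := Nat.coprime_div_gcd_div_gcd hg0
  have hc₁ : Nat.Coprime n₁' c.natAbs := by
    have h1 : IsCoprime (n₁' : ℤ) (n₂' : ℤ) := Nat.isCoprime_iff_coprime.mpr hcop
    have h2 : IsCoprime (n₁' : ℤ) c := by
      rw [show c = (n₂' : ℤ) + (n₁' : ℤ) * (-1) by rw [hc]; ring]
      exact h1.add_mul_left_right (-1)
    have h3 := Int.isCoprime_iff_gcd_eq_one.mp h2
    rw [Int.gcd_eq_natAbs, Int.natAbs_natCast] at h3
    exact h3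
  have hc₂ : Nat.Coprime n₂' c.natAbs := by
    have h1 : IsCoprime (n₂' : ℤ) (n₁' : ℤ) := Nat.isCoprime_iff_coprime.mpr hcop.symm
    have h2 : IsCoprime (n₂' : ℤ) c := by
      rw [show c = -((n₁' : ℤ) + (n₂' : ℤ) * (-1)) by rw [hc]; ring]
      exact (h1.add_mul_left_right (-1)).neg_right
    have h3 := Int.isCoprime_iff_gcd_eq_one.mp h2
    rw [Int.gcd_eq_natAbs, Int.natAbs_natCast] at h3
    exact h3
  -- compute
  rw [Int.gcd_eq_natAbs, Int.natAbs_mul, Int.natAbs_natCast,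
    Nat.Coprime.gcd_mul_left_cancel c.natAbs hkQ, hQeq,
    Nat.Coprime.gcd_mul_left_cancel_right (n₁' * g) hc₂,
    Nat.Coprime.gcd_mul_left_cancel_right g hc₁]
  exact Nat.gcd_le_right _ hg0

/-- `(m, [n₁, n₂]) = 1 ↔ (m, n₁) = 1 ∧ (m, n₂) = 1`. [folklore] -/
theorem DFI_coprime_lcm_iff {m n₁ n₂ : ℕ} :
    m.Coprime (n₁.lcm n₂) ↔ m.Coprime n₁ ∧ m.Coprime n₂ := by
  constructor
  · intro h
    exact ⟨Nat.Coprime.coprime_dvd_right (Nat.dvd_lcm_left n₁ n₂) h,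
      Nat.Coprime.coprime_dvd_right (Nat.dvd_lcm_right n₁ n₂) h⟩
  · rintro ⟨h₁, h₂⟩
    exact Nat.Coprime.coprime_dvd_right (Nat.lcm_dvd_mul n₁ n₂) (Nat.Coprime.mul_right h₁ h₂)

/-- **The sum over `m` for a pair of moduli** (the Weil bound of Duke–Friedlander–Iwaniec's
Theorem 5, one pair `(n₁, n₂)`): for `n₁, n₂ ≥ 1` coprime to `k` and `A ≥ 0`,
`‖∑_{1 ≤ m ≤ A, (m, n₁n₂) = 1} e(k m̄/n₁) conj e(k m̄/n₂)‖ ≤ A (n₁,n₂)²/(n₁n₂) + τ([n₁,n₂]) (n₁n₂)^{1/2} (1 + log [n₁,n₂])`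
(CRT: the summand is `e(kc · m̄/Q)`, `Q = [n₁,n₂]`, then completion + Weil with `(kc, Q) ≤ (n₁,n₂)`).
[cite: DukeFriedlanderIwaniec1997, Theorem 5 (proof)] -/
theorem DFI_pairSum_norm_le (k : ℤ) {n₁ n₂ : ℕ} (hn₁ : 0 < n₁) (hn₂ : 0 < n₂)
    (hk₁ : n₁.Coprime k.natAbs) (hk₂ : n₂.Coprime k.natAbs) (A : ℕ) :
    ‖∑ m ∈ Icc 1 A, (if m.Coprime n₁ ∧ m.Coprime n₂ then
        kfPhase k n₁ m * (starRingEnd ℂ) (kfPhase k n₂ m) else 0)‖ ≤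
      (A : ℝ) * (n₁.gcd n₂ : ℝ) ^ 2 / ((n₁ : ℝ) * n₂) +
        (Nat.divisors (n₁.lcm n₂)).card * Real.sqrt ((n₁ : ℝ) * n₂) *
          (1 + Real.log (n₁.lcm n₂)) := by
  set g : ℕ := n₁.gcd n₂ with hg
  set Q : ℕ := n₁.lcm n₂ with hQ
  set c : ℤ := ((n₂ / g : ℕ) : ℤ) - ((n₁ / g : ℕ) : ℤ) with hc
  have hg0 : 0 < g := Nat.gcd_pos_of_pos_left _ hn₁
  have hQ0 : 0 < Q := Nat.lcm_pos hn₁ hn₂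
  have hg0r : (0 : ℝ) < g := by exact_mod_cast hg0
  have hQ0r : (0 : ℝ) < Q := by exact_mod_cast hQ0
  have hgQ : (g : ℝ) * Q = n₁ * n₂ := by exact_mod_cast Nat.gcd_mul_lcm n₁ n₂
  -- CRT: rewrite the sum as an incomplete Kloosterman sum modulo `Q`
  have hsum : ∑ m ∈ Icc 1 A, (if m.Coprime n₁ ∧ m.Coprime n₂ then
        kfPhase k n₁ m * (starRingEnd ℂ) (kfPhase k n₂ m) else 0) =
      ∑ m ∈ (Icc 1 A).filter (fun m => m.Coprime Q), kfPhase (k * c) Q m := by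
    rw [Finset.sum_filter]
    refine Finset.sum_congr rfl fun m _ => ?_
    by_cases h : m.Coprime n₁ ∧ m.Coprime n₂
    · rw [if_pos h, if_pos (DFI_coprime_lcm_iff.mpr h)]
      exact DFI_kfPhase_mul_conj k hn₁ hn₂ h.1 h.2
    · rw [if_neg h, if_neg (fun h' => h (DFI_coprime_lcm_iff.mp h'))]
  rw [hsum]
  have h1 := KI_sum_Icc_coprime_le hQ0 (k * c) A
  have hG : (Int.gcd (k * c) Q : ℝ) ≤ g := Nat.cast_le.mpr (DFI_gcd_kc_lcm_le k hn₁ hk₁ hk₂)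
  have hG0 : (0 : ℝ) ≤ Int.gcd (k * c) Q := Nat.cast_nonneg _
  have hlog : 0 ≤ 1 + Real.log Q := by
    have : 0 ≤ Real.log Q := Real.log_nonneg (by exact_mod_cast hQ0)
    linarith
  refine h1.trans ?_
  have hfirst : (A : ℝ) / Q * Int.gcd (k * c) Q ≤ (A : ℝ) * (g : ℝ) ^ 2 / ((n₁ : ℝ) * n₂) := by
    calc (A : ℝ) / Q * Int.gcd (k * c) Q ≤ (A : ℝ) / Q * g := by gcongr
      _ = (A : ℝ) * (g : ℝ) ^ 2 / ((n₁ : ℝ) * n₂) := by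
          rw [← hgQ]; field_simp
  have hsecond : (Nat.divisors Q).card * Real.sqrt Q * Real.sqrt (Int.gcd (k * c) Q) *
      (1 + Real.log Q) ≤ (Nat.divisors Q).card * Real.sqrt ((n₁ : ℝ) * n₂) * (1 + Real.log Q) := by
    have hsq : Real.sqrt Q * Real.sqrt (Int.gcd (k * c) Q) ≤ Real.sqrt ((n₁ : ℝ) * n₂) := by
      rw [← Real.sqrt_mul hQ0r.le, ← hgQ, mul_comm (g : ℝ)]
      exact Real.sqrt_le_sqrt (by gcongr)
    calc (Nat.divisors Q).card * Real.sqrt Q * Real.sqrt (Int.gcd (k * c) Q) * (1 + Real.log Q)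
        = (Nat.divisors Q).card * (Real.sqrt Q * Real.sqrt (Int.gcd (k * c) Q)) *
            (1 + Real.log Q) := by ring
      _ ≤ (Nat.divisors Q).card * Real.sqrt ((n₁ : ℝ) * n₂) * (1 + Real.log Q) := by gcongr
  exact add_le_add hfirst hsecond

/-- **A gcd sum**: `∑_{1 ≤ n₂ ≤ X} (n₁, n₂) ≤ X τ(n₁)` for `n₁ ≥ 1` (group `n₂` by `d = (n₁, n₂) ∣ n₁`;
each class has at most `X/d` elements). [folklore] -/
theorem DFI_sum_gcd_le (X : ℕ) {n₁ : ℕ} (hn₁ : 0 < n₁) :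
    ∑ n₂ ∈ Icc 1 X, (n₁.gcd n₂ : ℝ) ≤ X * (Nat.divisors n₁).card := by
  rw [← Finset.sum_fiberwise_of_maps_to (g := fun n₂ => n₁.gcd n₂) (t := n₁.divisors)
    (fun n₂ _ => Nat.mem_divisors.mpr ⟨Nat.gcd_dvd_left n₁ n₂, hn₁.ne'⟩)]
  have hclass : ∀ d ∈ n₁.divisors,
      ∑ n₂ ∈ (Icc 1 X).filter (fun n₂ => n₁.gcd n₂ = d), (n₁.gcd n₂ : ℝ) ≤ X := by
    intro d hd
    have hd0 : 0 < d := Nat.pos_of_mem_divisors hd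
    calc ∑ n₂ ∈ (Icc 1 X).filter (fun n₂ => n₁.gcd n₂ = d), (n₁.gcd n₂ : ℝ)
        = ∑ n₂ ∈ (Icc 1 X).filter (fun n₂ => n₁.gcd n₂ = d), (d : ℝ) :=
          Finset.sum_congr rfl fun n₂ hn₂ => by rw [(Finset.mem_filter.mp hn₂).2]
      _ = ((Icc 1 X).filter (fun n₂ => n₁.gcd n₂ = d)).card * (d : ℝ) := by
          rw [Finset.sum_const, nsmul_eq_mul]
      _ ≤ ((Ioc 0 X).filter (fun n₂ => d ∣ n₂)).card * (d : ℝ) := by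
          gcongr
          intro n₂ hn₂
          rw [Finset.mem_filter] at hn₂ ⊢
          refine ⟨?_, hn₂.2 ▸ Nat.gcd_dvd_right n₁ n₂⟩
          rw [Finset.mem_Ioc]; rw [Finset.mem_Icc] at hn₂
          exact ⟨hn₂.1.1, hn₂.1.2⟩
      _ = (X / d : ℕ) * (d : ℝ) := by rw [Nat.Ioc_filter_dvd_card_eq_div]
      _ ≤ X := by
          have h := Nat.div_mul_le_self X d
          exact_mod_cast h
  calc ∑ d ∈ n₁.divisors, ∑ n₂ ∈ (Icc 1 X).filter (fun n₂ => n₁.gcd n₂ = d), (n₁.gcd n₂ : ℝ)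
      ≤ ∑ d ∈ n₁.divisors, (X : ℝ) := Finset.sum_le_sum hclass
    _ = X * (Nat.divisors n₁).card := by rw [Finset.sum_const, nsmul_eq_mul]; ring

end Literature.NumberTheory.LFunctions

end
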